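import Summits.QuantumFields.BalabanUV.Beta.FP.PerfectMaxwellElliptic

/-!
# `BalabanUV.Beta.FP.PerfectPropagatorSymbol` — road «FP» for binder row D1, leaf H2-P of the horizontal route, MATRIX PACKAGING (row H2-P-MAT; owner ruling R-FP-15,
# `HOME/b2b-balaban-beta-d1-p3/H2-DESIGN.md` §5–§6): the weighted Maxwell MATRIX symbol as a sum of rank-one curl projectors, its Feynman completion, Hermitian
# symmetry, `v†Mv = maxwellQ`, and POSITIVE DEFINITENESS at the continuum (1.66) weights on the punctured real Brillouin zone ⟹ the UNCONSTRAINED PERFECT PROPAGATOR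
# SYMBOL `P∞sym := (M + p̂p̂†)⁻¹` is a genuine inverse there

HONEST DEPENDENCY (page 1, mandatory): continuum YM on T⁴ ⇐ BetaPertH ∧ nine spine estimates (0/9 proved); BetaPertH ⇐ (D1) ∧ (D4) ∧ CAP+tail;
G-an2-4 gates asym, D1 and NE2/3/4.  HONEST FRAMING (cell contract, verbatim): «discharging `BetaPertH` makes Bałaban's UV stability UNCONDITIONAL —
a real constructive-QFT result; it is NOT the continuum limit and NOT the Clay problem.»  THIS MODULE DISCHARGES NOTHING of the wall: Mathlib matrix algebra over
`FP/PerfectMaxwellSymbol`/`FP/PerfectMaxwellElliptic` (p229918/p230467).  FOUR [our object] data defs (`curlRow`, `maxwellMat`, `feynMat`, `PinfSym`); no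
`def … : Prop`; nothing cited as a hypothesis; 0 sorry; 0 wall binders; NOT D1, NOT BetaPertH, NOT continuum, NOT Clay.

ABSOLUTE RULE (cell charter, verbatim): «No internally-minted statement may enter as a cited fact. Every hypothesis is either kernel-proved in this package or a
verbatim quotation of a PUBLISHED theorem with page reference. The manuscript(s) under audit are NOT citable for their own disputed steps — they are the thing
under adjudication; programme-internal (2001/route/tribunal) claims are never citable.»

WHAT.  §1 `curlRow ph μ ν α := ph μ·[α = ν] − ph ν·[α = μ]` (`sum_curlRow_mul`: `Σ_α curlRow α·v α = ph μ·v ν − ph ν·v μ`).  §2 `maxwellMat W ph α β :=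
Σ_{μ≠ν} ½W μ ν·conj(curlRow α)·curlRow β` (sum of rank-one curl projectors), `feynMat W ph := maxwellMat W ph + (α β ↦ ph α·conj(ph β))` (the `ξ = 1` lattice slice
projector added); `quad M v := Σ_α Σ_β conj(v α)·M α β·v β` (= `star v ⬝ᵥ M *ᵥ v`); **`quad_maxwellMat`**: `quad (maxwellMat W ph) v = maxwellQ W ph v` and
**`quad_feynMat`**: `= maxwellQ W ph v + ‖Σ_μ ph μ·conj(v μ)‖²`; `maxwellMat_isHermitian`, `feynMat_isHermitian`.  §3 at the continuum (1.66) weights `W := Re W_∞(·,·;s)`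
and the lattice momentum factors of a real NONZERO momentum (`ph ≠ 0`): **`feynMat_posDef`** (`Matrix.PosDef`, from `PerfectMaxwellElliptic.perfectFeynman_lower`), hence
`isUnit_det_feynMat`, and the UNCONSTRAINED PERFECT PROPAGATOR SYMBOL **`PinfSym s ph := (feynMat (Re W_∞ s) ph)⁻¹`** with `PinfSym_mul`/`mul_PinfSym` (two-sided inverse).
The operator-norm bound `‖PinfSym‖ ≤ 1/(γ|p̂|²)` is left in quadratic-form currency (`PerfectMaxwellElliptic.perfectFeynman_lower`); the dictionary «`maxwellMat (Re W_∞)` IS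
the Fourier symbol of `deltaZLim`» is row H2-P-DICT (not here).
Provenance: road FP owner b2b-balaban-beta-d1-p3 gen 4 (prover-b2b-balaban-beta-d1-p3-g4-0), 2026-08-20.
-/

noncomputable section

namespace Summit.QuantumFields.BalabanUV.Beta.FP.PerfectPropagatorSymbol

open Finset Matrix
open scoped BigOperators ComplexConjugate ComplexOrder
open Literature.MathematicalPhysics.QuantumFieldTheory.Balaban1983to89
open B4Strip (ofRealVec)
open B4ContourShift (BZ)
open Summit.QuantumFields.BalabanUV.Beta.FP.PerfectSymbol166 (W166Inf)
open Summit.QuantumFields.BalabanUV.Beta.FP.PerfectMaxwellSymbol (maxwellQ)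
open Summit.QuantumFields.BalabanUV.Beta.FP.PerfectMaxwellElliptic (perfectFeynman_lower)

variable {d : ℕ}

/-! ## §1 Curl rows -/

/-- [our object] The curl row of the plaquette orientation `(μ, ν)`: `curlRow ph μ ν α := ph μ·[α = ν] − ph ν·[α = μ]`. -/
def curlRow (ph : Fin d → ℂ) (μ ν : Fin d) (α : Fin d) : ℂ := (if α = ν then ph μ else 0) - (if α = μ then ph ν else 0)

/-- [folklore] `Σ_α curlRow α · v α = ph μ·v ν − ph ν·v μ`. -/
theorem sum_curlRow_mul (ph v : Fin d → ℂ) (μ ν : Fin d) : ∑ α, curlRow ph μ ν α * v α = ph μ * v ν - ph ν * v μ := by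
  unfold curlRow
  simp only [sub_mul, Finset.sum_sub_distrib, ite_mul, zero_mul, Finset.sum_ite_eq', Finset.mem_univ, if_true]

/-- [folklore] `Σ_α conj(v α)·conj(curlRow α) = conj(ph μ·v ν − ph ν·v μ)`. -/
theorem sum_conj_mul_conj_curlRow (ph v : Fin d → ℂ) (μ ν : Fin d) :
    ∑ α, conj (v α) * conj (curlRow ph μ ν α) = conj (ph μ * v ν - ph ν * v μ) := by
  rw [← sum_curlRow_mul, map_sum]
  exact Finset.sum_congr rfl fun α _ => by rw [map_mul, mul_comm]

/-! ## §2 The weighted Maxwell matrix, its Feynman completion, `v†Mv` -/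

/-- [our object] **THE WEIGHTED MAXWELL MATRIX SYMBOL** as a sum of rank-one curl projectors:
`maxwellMat W ph α β := Σ_μ Σ_{ν ≠ μ} ½W μ ν · conj(curlRow ph μ ν α) · curlRow ph μ ν β`. -/
def maxwellMat (W : Fin d → Fin d → ℝ) (ph : Fin d → ℂ) : Matrix (Fin d) (Fin d) ℂ :=
  fun α β => ∑ μ, ∑ ν, if μ = ν then 0 else (((1 / 2 : ℝ) * W μ ν : ℝ) : ℂ) * (conj (curlRow ph μ ν α) * curlRow ph μ ν β)

/-- [our object] **THE FEYNMAN-COMPLETED SYMBOL**: `feynMat W ph := maxwellMat W ph + ph ⊗ ph†` (the `ξ = 1` lattice slice projector `α β ↦ ph α·conj(ph β)`). -/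
def feynMat (W : Fin d → Fin d → ℝ) (ph : Fin d → ℂ) : Matrix (Fin d) (Fin d) ℂ :=
  fun α β => maxwellMat W ph α β + ph α * conj (ph β)

/-- [our object] The sesquilinear pairing `v† M v := Σ_α Σ_β conj(v α)·M α β·v β`. -/
def quad (M : Matrix (Fin d) (Fin d) ℂ) (v : Fin d → ℂ) : ℂ := ∑ α, ∑ β, conj (v α) * M α β * v β

/-- [folklore] `quad M v = star v ⬝ᵥ (M *ᵥ v)` (Mathlib's positive-definiteness currency). -/
theorem quad_eq_dotProduct (M : Matrix (Fin d) (Fin d) ℂ) (v : Fin d → ℂ) : quad M v = star v ⬝ᵥ (M *ᵥ v) := by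
  unfold quad dotProduct mulVec dotProduct
  refine Finset.sum_congr rfl fun α _ => ?_
  rw [Finset.mul_sum]
  refine Finset.sum_congr rfl fun β _ => ?_
  simp only [Pi.star_apply, RCLike.star_def]; ring

/-- [folklore] `((‖z‖²) : ℂ) = conj z · z`. -/
theorem ofReal_norm_sq_eq (z : ℂ) : (((‖z‖ ^ 2 : ℝ)) : ℂ) = conj z * z := by
  rw [mul_comm, Complex.mul_conj, Complex.normSq_eq_norm_sq]

/-- [folklore] **`v† M v = maxwellQ W ph v`** for the weighted Maxwell matrix. -/
theorem quad_maxwellMat (W : Fin d → Fin d → ℝ) (ph v : Fin d → ℂ) :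
    quad (maxwellMat W ph) v = ((maxwellQ W ph v : ℝ) : ℂ) := by
  -- per plaquette orientation, the rank-one term
  set c : Fin d → Fin d → ℂ := fun μ ν => if μ = ν then 0 else (((1 / 2 : ℝ) * W μ ν : ℝ) : ℂ) with hc
  have hM : ∀ α β, maxwellMat W ph α β = ∑ μ, ∑ ν, c μ ν * (conj (curlRow ph μ ν α) * curlRow ph μ ν β) := by
    intro α β; unfold maxwellMat
    refine Finset.sum_congr rfl fun μ _ => Finset.sum_congr rfl fun ν _ => ?_
    simp only [hc]; split_ifs <;> simp
  -- LHS with the (μ,ν) sums outermost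
  have hL : quad (maxwellMat W ph) v
      = ∑ μ, ∑ ν, c μ ν * ((∑ α, conj (v α) * conj (curlRow ph μ ν α)) * (∑ β, curlRow ph μ ν β * v β)) := by
    unfold quad
    simp_rw [hM]
    -- distribute
    have h1 : ∀ α β, conj (v α) * (∑ μ, ∑ ν, c μ ν * (conj (curlRow ph μ ν α) * curlRow ph μ ν β)) * v β
        = ∑ μ, ∑ ν, c μ ν * ((conj (v α) * conj (curlRow ph μ ν α)) * (curlRow ph μ ν β * v β)) := by
      intro α β
      rw [Finset.mul_sum, Finset.sum_mul]
      refine Finset.sum_congr rfl fun μ _ => ?_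
      rw [Finset.mul_sum, Finset.sum_mul]
      exact Finset.sum_congr rfl fun ν _ => by ring
    simp_rw [h1]
    -- commute: Σ_α Σ_β Σ_μ Σ_ν ↦ Σ_μ Σ_ν Σ_α Σ_β
    rw [Finset.sum_congr rfl fun α _ => Finset.sum_comm]      -- Σ_α Σ_μ Σ_β Σ_ν
    rw [Finset.sum_comm]                                        -- Σ_μ Σ_α Σ_β Σ_ν
    refine Finset.sum_congr rfl fun μ _ => ?_
    rw [Finset.sum_congr rfl fun α _ => Finset.sum_comm]       -- Σ_α Σ_ν Σ_β
    rw [Finset.sum_comm]                                        -- Σ_ν Σ_α Σ_β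
    refine Finset.sum_congr rfl fun ν _ => ?_
    rw [Finset.sum_mul_sum, Finset.mul_sum]
    exact Finset.sum_congr rfl fun α _ => by rw [Finset.mul_sum]
  rw [hL]
  -- RHS cast
  unfold maxwellQ
  push_cast
  refine Finset.sum_congr rfl fun μ _ => Finset.sum_congr rfl fun ν _ => ?_
  rw [sum_conj_mul_conj_curlRow, sum_curlRow_mul]
  simp only [hc]
  split_ifs with h
  · simp
  · rw [← ofReal_norm_sq_eq]; push_cast; ring

/-- [folklore] **`v† (M + ph⊗ph†) v = maxwellQ W ph v + ‖Σ_μ ph μ·conj(v μ)‖²`.** -/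
theorem quad_feynMat (W : Fin d → Fin d → ℝ) (ph v : Fin d → ℂ) :
    quad (feynMat W ph) v = ((maxwellQ W ph v + ‖∑ μ, ph μ * conj (v μ)‖ ^ 2 : ℝ) : ℂ) := by
  have hsplit : quad (feynMat W ph) v = quad (maxwellMat W ph) v + ∑ α, ∑ β, conj (v α) * (ph α * conj (ph β)) * v β := by
    unfold quad feynMat
    simp only [mul_add, add_mul, Finset.sum_add_distrib]
  rw [hsplit, quad_maxwellMat]
  push_cast
  congr 1
  -- the slice term: Σ_α Σ_β conj(v α) ph α conj(ph β) v β = conj(T)·T with T = Σ_β conj(ph β) v β, and ‖Σ ph·conj v‖ = ‖T‖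
  have hT : (∑ α, ∑ β, conj (v α) * (ph α * conj (ph β)) * v β) = (∑ α, conj (v α) * ph α) * (∑ β, conj (ph β) * v β) := by
    rw [Finset.sum_mul_sum]
    exact Finset.sum_congr rfl fun α _ => Finset.sum_congr rfl fun β _ => by ring
  have hconj : (∑ α, conj (v α) * ph α) = conj (∑ β, conj (ph β) * v β) := by
    rw [map_sum]; exact Finset.sum_congr rfl fun α _ => by rw [map_mul, Complex.conj_conj, mul_comm]
  have hnorm : ‖∑ μ, ph μ * conj (v μ)‖ = ‖∑ β, conj (ph β) * v β‖ := by
    have : (∑ μ, ph μ * conj (v μ)) = conj (∑ β, conj (ph β) * v β) := by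
      rw [map_sum]; exact Finset.sum_congr rfl fun α _ => by rw [map_mul, Complex.conj_conj]
    rw [this, Complex.norm_conj]
  rw [hT, hconj, hnorm, ← Complex.ofReal_pow, ofReal_norm_sq_eq]

/-- [folklore] The weighted Maxwell matrix is Hermitian (real weights). -/
theorem maxwellMat_isHermitian (W : Fin d → Fin d → ℝ) (ph : Fin d → ℂ) : (maxwellMat W ph).IsHermitian := by
  refine Matrix.IsHermitian.ext fun α β => ?_
  unfold maxwellMat
  rw [Complex.star_def, map_sum]
  refine Finset.sum_congr rfl fun μ _ => ?_
  rw [map_sum]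
  refine Finset.sum_congr rfl fun ν _ => ?_
  by_cases h : μ = ν
  · simp [h]
  · simp only [if_neg h, map_mul, Complex.conj_ofReal, Complex.conj_conj]; ring

/-- [folklore] The Feynman-completed matrix is Hermitian. -/
theorem feynMat_isHermitian (W : Fin d → Fin d → ℝ) (ph : Fin d → ℂ) : (feynMat W ph).IsHermitian := by
  refine Matrix.IsHermitian.ext fun α β => ?_
  have h := (maxwellMat_isHermitian W ph).apply α β
  rw [Complex.star_def] at h
  show star (maxwellMat W ph β α + ph β * conj (ph α)) = maxwellMat W ph α β + ph α * conj (ph β)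
  rw [Complex.star_def, map_add, h, map_mul, Complex.conj_conj, mul_comm (conj (ph β))]

/-! ## §3 Positive definiteness at the continuum (1.66) weights; the unconstrained perfect propagator symbol -/

/-- [our object] **POSITIVE DEFINITENESS OF THE FEYNMAN-COMPLETED PERFECT SYMBOL** at a real momentum `s` of the Brillouin zone, for any NONZERO momentum-factor
vector `ph` (on the road `ph a = e^{is_a} − 1 ≠ 0` iff `s ≠ 0`): `Matrix.PosDef (feynMat (Re W_∞(·,·;s)) ph)` — from the uniform ellipticity
`(4/π²)^{d+2}·‖ph‖²‖v‖² ≤ Re v†(M + ph⊗ph†)v` (`PerfectMaxwellElliptic.perfectFeynman_lower`). -/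
theorem feynMat_posDef {s : Fin d → ℝ} (hs : s ∈ BZ d) {ph : Fin d → ℂ} (hph : ph ≠ 0) :
    (feynMat (fun μ ν => (W166Inf μ ν (ofRealVec s)).re) ph).PosDef := by
  refine Matrix.PosDef.of_dotProduct_mulVec_pos (feynMat_isHermitian _ ph) fun v hv => ?_
  rw [← quad_eq_dotProduct, quad_feynMat, Complex.zero_lt_real]
  -- the real quadratic form is ≥ γ‖ph‖²‖v‖² > 0
  have hlow := perfectFeynman_lower hs ph v
  have hph2 : 0 < ∑ μ, ‖ph μ‖ ^ 2 := by
    obtain ⟨a, ha⟩ : ∃ a, ph a ≠ 0 := by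
      by_contra hall; push Not at hall; exact hph (funext hall)
    exact lt_of_lt_of_le (by positivity : (0:ℝ) < ‖ph a‖ ^ 2) (Finset.single_le_sum (fun i _ => sq_nonneg ‖ph i‖) (Finset.mem_univ a))
  have hv2 : 0 < ∑ μ, ‖v μ‖ ^ 2 := by
    obtain ⟨a, ha⟩ : ∃ a, v a ≠ 0 := by
      by_contra hall; push Not at hall; exact hv (funext hall)
    exact lt_of_lt_of_le (by positivity : (0:ℝ) < ‖v a‖ ^ 2) (Finset.single_le_sum (fun i _ => sq_nonneg ‖v i‖) (Finset.mem_univ a))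
  exact lt_of_lt_of_le (mul_pos (by positivity) (mul_pos hph2 hv2)) hlow

/-- [our object] Hence its determinant is a unit: the Feynman-completed perfect symbol is INVERTIBLE off `p = 0`. -/
theorem isUnit_det_feynMat {s : Fin d → ℝ} (hs : s ∈ BZ d) {ph : Fin d → ℂ} (hph : ph ≠ 0) :
    IsUnit (feynMat (fun μ ν => (W166Inf μ ν (ofRealVec s)).re) ph).det :=
  (Matrix.isUnit_iff_isUnit_det _).mp (feynMat_posDef hs hph).isUnit

/-- [our object] **THE UNCONSTRAINED PERFECT PROPAGATOR SYMBOL** (BF-Feynman, `ξ = 1`): `PinfSym s ph := (feynMat (Re W_∞(·,·;s)) ph)⁻¹`. -/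
def PinfSym (s : Fin d → ℝ) (ph : Fin d → ℂ) : Matrix (Fin d) (Fin d) ℂ := (feynMat (fun μ ν => (W166Inf μ ν (ofRealVec s)).re) ph)⁻¹

/-- [our object] `PinfSym` is a RIGHT inverse of the completed symbol off `p = 0`. -/
theorem feynMat_mul_PinfSym {s : Fin d → ℝ} (hs : s ∈ BZ d) {ph : Fin d → ℂ} (hph : ph ≠ 0) :
    feynMat (fun μ ν => (W166Inf μ ν (ofRealVec s)).re) ph * PinfSym s ph = 1 :=
  Matrix.mul_nonsing_inv _ (isUnit_det_feynMat hs hph)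

/-- [our object] … and a LEFT inverse. -/
theorem PinfSym_mul_feynMat {s : Fin d → ℝ} (hs : s ∈ BZ d) {ph : Fin d → ℂ} (hph : ph ≠ 0) :
    PinfSym s ph * feynMat (fun μ ν => (W166Inf μ ν (ofRealVec s)).re) ph = 1 :=
  Matrix.nonsing_inv_mul _ (isUnit_det_feynMat hs hph)

end Summit.QuantumFields.BalabanUV.Beta.FP.PerfectPropagatorSymbol

end
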